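import Mathlib
import Literature.NumberTheory.LFunctions.Zhang2022.Section17SwapLemmas
import Literature.NumberTheory.LFunctions.Zhang2022.Section15Bcoef
import HarnessLib

/-!
# Zhang (2022), §17.u023 / GAP row G-L4t6-1a: `Swap17` — the weight swap `χκ̄₂ ↔ ϱ*₁` costs
# `O(𝓛⁻⁸τ₂(l₁))` under (A), kernel-checked

Topic `Literature/NumberTheory/LFunctions/Zhang2022` (Landau–Siegel audit tree; verdict-neutral).
Y. Zhang, arXiv:2211.02515v1 (2022) [Zhang2022LandauSiegel] — an unrefereed manuscript under
adjudication; nothing here bears on its Theorems 1–2. §17 p.98 (tex L4830–4838) applies Lemma 15.1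
to `Σ_{(m₁,𝔮)=1} b(l₁m₁)κ̄₂(m₁)/m₁`, whose weight is not Lemma 15.1's `χ(m)ϱ*₁(m)`; the cell's repair
(G-L4t6-1a, RULING 13d) is `Skeleton.Lemma151Chi` plus THIS estimate: for all large `D`, under (A),
for every `l₁ ≥ 1`, `Σ_{m<⌈P⌉,(m,𝔮)=1} |b(l₁m)|·|χ(m)κ̄₂(m) − ϱ*₁(m)|/m ≤ C·𝓛⁻⁸·τ₂(l₁)`
(`swap17_bound`; in fact `≪ 𝓛⁻⁹³³τ₂(l₁)`). Mechanism of (B.1) (App. B p.106, tex L5256–5266):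
`|χκ̄₂ − ϱ*₁|(m) ≤ Σ_{h∣m,h>1}|ν(h)|τ₂(m/h)` (`Section17SwapLemmas`), `|b(l₁m)| ≤ C₀τ₂(l₁)τ₂(m)`
((15.2), `Skeleton.norm_bcoef_le`), `(m,𝔮)=1 ∧ h∣m ∧ h>1 ⇒ h > D⁴`, `m = hk`, `τ₂(hk) ≤ τ₂(h)τ₂(k)`,
then Cauchy–Schwarz with the tree's Lemma 3.1 (`Lemma31.lemma_3_1`: `Σ_{D⁴<h≤P²}ν²/h ≪ 𝓛⁻²⁰¹¹`) and
`Σ_{n≤X}τ₂(n)²/n ≪ log⁴X` (`MeanSquareMajorant.sum_tau_sq_div_le`). 0 new facts.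
[cite: Zhang2022LandauSiegel, §17 p.98; App. B (B.1) p.106]
-/

noncomputable section

open Complex Real ComplexConjugate Finset

namespace Literature.NumberTheory.LFunctions.Zhang2022.Skeleton

/-! ## §1. Divisor-sum rearrangements -/

/-- `#{e ∣ m : h ∣ e} = τ₂(m/h)` for `h ∣ m`, `m ≠ 0` (`e ↦ e/h`). [folklore] -/
private theorem card_filter_dvd_divisors {m h : ℕ} (hm : m ≠ 0) (hh : h ∣ m) :
    ((m.divisors).filter (fun e => h ∣ e)).card = (m / h).divisors.card := by
  have hh0 : h ≠ 0 := ne_zero_of_dvd_ne_zero hm hh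
  have hset : (m.divisors).filter (fun e => h ∣ e) = ((m / h).divisors).image (fun e' => h * e') := by
    ext e
    simp only [Finset.mem_filter, Nat.mem_divisors, Finset.mem_image]
    constructor
    · rintro ⟨⟨hem, _⟩, ⟨e', rfl⟩⟩
      refine ⟨e', ⟨?_, ?_⟩, rfl⟩
      · obtain ⟨c, hc⟩ := hem
        refine ⟨c, ?_⟩
        rw [mul_assoc] at hc
        rw [hc, Nat.mul_div_cancel_left _ (Nat.pos_of_ne_zero hh0)]
      · intro h0
        have : h * (m / h) = m := Nat.mul_div_cancel' hh
        rw [h0, mul_zero] at this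
        exact hm this.symm
    · rintro ⟨e', ⟨he', _⟩, rfl⟩
      refine ⟨⟨?_, hm⟩, dvd_mul_right h e'⟩
      have := Nat.mul_dvd_mul_left h he'
      rwa [Nat.mul_div_cancel' hh] at this
  rw [hset, Finset.card_image_of_injective _ (fun a b hab => Nat.eq_of_mul_eq_mul_left
    (Nat.pos_of_ne_zero hh0) hab)]

/-- `Σ_{e∣m} Σ_{h∣e, h>1} g(h) = Σ_{h∣m, h>1} g(h)·τ₂(m/h)` for `m ≥ 1`. [folklore] -/
private theorem sum_divisors_sum_erase_eq {m : ℕ} (hm : m ≠ 0) (g : ℕ → ℝ) :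
    ∑ e ∈ m.divisors, ∑ h ∈ e.divisors.erase 1, g h =
      ∑ h ∈ m.divisors.erase 1, g h * ((m / h).divisors.card : ℝ) := by
  classical
  have h1 : ∀ e ∈ m.divisors, ∑ h ∈ e.divisors.erase 1, g h =
      ∑ h ∈ m.divisors.erase 1, (if h ∣ e then g h else 0) := by
    intro e he
    rw [← Finset.sum_filter]
    refine Finset.sum_congr ?_ fun _ _ => rfl
    ext h
    have hem : e ∣ m := Nat.dvd_of_mem_divisors he
    simp only [Finset.mem_erase, Nat.mem_divisors, Finset.mem_filter]
    constructor
    · rintro ⟨hne, hhe, he0⟩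
      exact ⟨⟨hne, hhe.trans hem, hm⟩, hhe⟩
    · rintro ⟨⟨hne, _, _⟩, hhe⟩
      exact ⟨hne, hhe, ne_zero_of_dvd_ne_zero hm hem⟩
  rw [Finset.sum_congr rfl h1, Finset.sum_comm]
  refine Finset.sum_congr rfl fun h hh => ?_
  rw [← Finset.sum_filter, Finset.sum_const, nsmul_eq_mul, mul_comm]
  have hhm : h ∣ m := Nat.dvd_of_mem_divisors (Finset.mem_of_mem_erase hh)
  rw [card_filter_dvd_divisors hm hhm]

/-- `τ₂(uv) ≤ τ₂(u)τ₂(v)`. [folklore] -/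
private theorem card_divisors_mul_le'' (u v : ℕ) :
    (u * v).divisors.card ≤ u.divisors.card * v.divisors.card := by
  rw [Nat.divisors_mul]; exact Finset.card_mul_le

/-- For `h ≥ 1` and `T ⊆ [1,N)`: `Σ_{m∈T, h∣m} τ₂(m)τ₂(m/h)/m ≤ (τ₂(h)/h)·Σ_{k<N} τ₂(k)²/k`
(`m = hk`, `τ₂(hk) ≤ τ₂(h)τ₂(k)`). [cite: Zhang2022LandauSiegel, App. B p.106] -/
private theorem sum_filter_dvd_tau_le {h N : ℕ} (hh : 1 ≤ h) {T : Finset ℕ} (hT : T ⊆ Finset.Ico 1 N) :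
    ∑ m ∈ T.filter (fun m => h ∣ m), ((m.divisors.card : ℝ) * (m / h).divisors.card / m) ≤
      (h.divisors.card : ℝ) / h * ∑ k ∈ Finset.Ico 1 N, ((k.divisors.card : ℝ) ^ 2 / k) := by
  have hh0 : h ≠ 0 := by omega
  have hinj : Set.InjOn (fun k : ℕ => h * k) ↑(Finset.Ico 1 N) := fun a _ b _ hab =>
    Nat.eq_of_mul_eq_mul_left (Nat.pos_of_ne_zero hh0) hab
  have hsub : T.filter (fun m => h ∣ m) ⊆ (Finset.Ico 1 N).image (fun k => h * k) := by
    intro m hmT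
    rw [Finset.mem_filter] at hmT
    obtain ⟨k, rfl⟩ := hmT.2
    have hk := hT hmT.1
    rw [Finset.mem_Ico] at hk
    refine Finset.mem_image.mpr ⟨k, Finset.mem_Ico.mpr ⟨?_, ?_⟩, rfl⟩
    · rcases Nat.eq_zero_or_pos k with rfl | hk0
      · simp at hk
      · exact hk0
    · exact lt_of_le_of_lt (Nat.le_mul_of_pos_left k (Nat.pos_of_ne_zero hh0)) hk.2
  calc ∑ m ∈ T.filter (fun m => h ∣ m), ((m.divisors.card : ℝ) * (m / h).divisors.card / m)
      ≤ ∑ m ∈ (Finset.Ico 1 N).image (fun k => h * k),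
          ((m.divisors.card : ℝ) * (m / h).divisors.card / m) :=
        Finset.sum_le_sum_of_subset_of_nonneg hsub fun m _ _ => by positivity
    _ = ∑ k ∈ Finset.Ico 1 N,
          ((((h * k).divisors.card : ℝ) * ((h * k) / h).divisors.card / ((h * k : ℕ) : ℝ))) :=
        Finset.sum_image hinj
    _ ≤ ∑ k ∈ Finset.Ico 1 N, ((h.divisors.card : ℝ) / h * ((k.divisors.card : ℝ) ^ 2 / k)) := by
        refine Finset.sum_le_sum fun k hk => ?_
        rw [Finset.mem_Ico] at hk
        have hk0 : (0 : ℝ) < k := by exact_mod_cast hk.1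
        have hh' : (0 : ℝ) < h := by exact_mod_cast Nat.pos_of_ne_zero hh0
        rw [Nat.mul_div_cancel_left k (Nat.pos_of_ne_zero hh0), Nat.cast_mul]
        have hcard : ((h * k).divisors.card : ℝ) ≤ h.divisors.card * k.divisors.card := by
          exact_mod_cast card_divisors_mul_le'' h k
        rw [div_le_iff₀ (mul_pos hh' hk0)]
        calc ((h * k).divisors.card : ℝ) * k.divisors.card
            ≤ (h.divisors.card * k.divisors.card) * k.divisors.card :=
              mul_le_mul_of_nonneg_right hcard (Nat.cast_nonneg _)
          _ = (h.divisors.card : ℝ) / h * ((k.divisors.card : ℝ) ^ 2 / k) * (h * k) := by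
              field_simp
    _ = (h.divisors.card : ℝ) / h * ∑ k ∈ Finset.Ico 1 N, ((k.divisors.card : ℝ) ^ 2 / k) := by
        rw [Finset.mul_sum]

/-- **The rearranged majorant.** For `T ⊆ [1,N)` closed under divisors and `g ≥ 0`:
`Σ_{m∈T} τ₂(m)·(Σ_{h∣m,h>1} g(h)τ₂(m/h))/m ≤ (Σ_{h∈T,h>1} g(h)τ₂(h)/h)·Σ_{k<N} τ₂(k)²/k`.
[cite: Zhang2022LandauSiegel, App. B p.106] -/
private theorem sum_tau_majorant_le {N : ℕ} {T : Finset ℕ} (hT : T ⊆ Finset.Ico 1 N)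
    (hdiv : ∀ n ∈ T, ∀ d : ℕ, d ∣ n → d ∈ T) (g : ℕ → ℝ) (hg : ∀ h, 0 ≤ g h) :
    ∑ m ∈ T, ((m.divisors.card : ℝ) * (∑ h ∈ m.divisors.erase 1, g h * ((m / h).divisors.card : ℝ)) / m)
      ≤ (∑ h ∈ T.erase 1, g h * (h.divisors.card : ℝ) / h) *
          ∑ k ∈ Finset.Ico 1 N, ((k.divisors.card : ℝ) ^ 2 / k) := by
  classical
  set K : ℝ := ∑ k ∈ Finset.Ico 1 N, ((k.divisors.card : ℝ) ^ 2 / k) with hK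
  -- rewrite the inner sums over the fixed index set `T.erase 1`
  have h1 : ∀ m ∈ T, (m.divisors.card : ℝ) * (∑ h ∈ m.divisors.erase 1, g h * ((m / h).divisors.card : ℝ)) / m
      = ∑ h ∈ T.erase 1, (if h ∣ m then g h * ((m.divisors.card : ℝ) * (m / h).divisors.card / m) else 0) := by
    intro m hm
    have hm1 := hT hm
    rw [Finset.mem_Ico] at hm1
    have hm0 : m ≠ 0 := by omega
    rw [Finset.mul_sum, Finset.sum_div, ← Finset.sum_filter]
    refine Finset.sum_congr ?_ fun h _ => by ring
    ext h
    simp only [Finset.mem_erase, Nat.mem_divisors, Finset.mem_filter]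
    constructor
    · rintro ⟨hne, hhm, _⟩
      exact ⟨⟨hne, hdiv m hm h hhm⟩, hhm⟩
    · rintro ⟨⟨hne, _⟩, hhm⟩
      exact ⟨hne, hhm, hm0⟩
  rw [Finset.sum_congr rfl h1, Finset.sum_comm, Finset.sum_mul]
  refine Finset.sum_le_sum fun h hh => ?_
  rw [← Finset.sum_filter]
  have hhT : h ∈ T := Finset.mem_of_mem_erase hh
  have hh1 : 1 ≤ h := by have := hT hhT; rw [Finset.mem_Ico] at this; exact this.1
  calc ∑ m ∈ T.filter (fun m => h ∣ m), g h * ((m.divisors.card : ℝ) * (m / h).divisors.card / m)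
      = g h * ∑ m ∈ T.filter (fun m => h ∣ m), ((m.divisors.card : ℝ) * (m / h).divisors.card / m) := by
        rw [Finset.mul_sum]
    _ ≤ g h * ((h.divisors.card : ℝ) / h * K) :=
        mul_le_mul_of_nonneg_left (sum_filter_dvd_tau_le hh1 hT) (hg h)
    _ = g h * (h.divisors.card : ℝ) / h * K := by ring

/-! ## §2. Sizes and the main bound -/

/-- Members `h > 1` of `R = {1 ≤ n < N : (n,𝔮) = 1}` exceed `D⁴` (a prime factor of `h` is `≥ D⁴`, and
`h ≠ D⁴` since `D⁴` shares the primes of `D ≥ 2` with `𝔮`). [cite: Zhang2022LandauSiegel, App. B p.106] -/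
private theorem pow_four_lt_of_coprime_frakq {D h : ℕ} (hD : 2 ≤ D) (hh1 : h ≠ 1) (hh0 : h ≠ 0)
    (hcop : Nat.Coprime h (frakq D)) : D ^ 4 < h := by
  have hprime_dvd : ∀ p : ℕ, p.Prime → p < D ^ 4 → p ∣ frakq D := fun p hp hlt => by
    rw [frakq]; exact Finset.dvd_prod_of_mem _ (Finset.mem_filter.mpr ⟨Finset.mem_range.mpr hlt, hp⟩)
  have hp := Nat.minFac_prime hh1
  have hpd : h.minFac ∣ h := Nat.minFac_dvd h
  have hge : D ^ 4 ≤ h.minFac := by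
    by_contra hlt
    rw [not_le] at hlt
    have h1 : h.minFac ∣ Nat.gcd h (frakq D) := Nat.dvd_gcd hpd (hprime_dvd _ hp hlt)
    rw [hcop.gcd_eq_one] at h1
    exact hp.one_lt.ne' (Nat.dvd_one.mp h1)
  have hle : h.minFac ≤ h := Nat.minFac_le (Nat.pos_of_ne_zero hh0)
  rcases (le_trans hge hle).lt_or_eq with hlt | heq
  · exact hlt
  · exfalso
    -- `h = D⁴`: its least prime factor divides `D`, so it is `≤ D < D⁴`
    have hpD : h.minFac ∣ D := by
      have : h.minFac ∣ D ^ 4 := heq ▸ hpd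
      exact hp.dvd_of_dvd_pow this
    have hpleD : h.minFac ≤ D := Nat.le_of_dvd (by omega) hpD
    have hDlt : D < D ^ 4 := lt_of_eq_of_lt (pow_one D).symm (Nat.pow_lt_pow_right hD (by norm_num))
    omega

/-- `ab/h ≤ (λa²/h + b²/(λh))/2` for `λ, h > 0` (Cauchy–Schwarz, termwise). [folklore] -/
private theorem mul_div_le_weighted {lam a b h : ℝ} (hh : 0 < h) (hl : 0 < lam) :
    a * b / h ≤ (lam * (a ^ 2 / h) + lam⁻¹ * (b ^ 2 / h)) / 2 := by
  have e : (lam * (a ^ 2 / h) + lam⁻¹ * (b ^ 2 / h)) / 2 - a * b / h =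
      (lam * a - b) ^ 2 / (2 * lam * h) := by
    field_simp
    ring
  have h2 : 0 ≤ (lam * a - b) ^ 2 / (2 * lam * h) := by positivity
  linarith

/-- `L^a/L^b ≤ 1/L^c` when `a + c ≤ b` and `L ≥ 1`. [folklore] -/
private theorem pow_div_pow_le_one_div {L : ℝ} (hL : 1 ≤ L) {a b c : ℕ} (habc : a + c ≤ b) :
    L ^ a / L ^ b ≤ 1 / L ^ c := by
  have hL0 : 0 < L := by linarith
  rw [div_le_div_iff₀ (pow_pos hL0 _) (pow_pos hL0 _), one_mul, ← pow_add]
  exact pow_le_pow_right₀ hL habc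

/-- **`Swap17` (RULING 13d, GAP row G-L4t6-1a)**: for every real `c′` there is `C` such that for all
large `D`, every real primitive `χ (mod D)` under (A) and every `l₁ ≥ 1`,
`Σ_{1≤m<⌈P⌉, (m,𝔮)=1} |b(l₁m)|·|χ(m)κ̄₂(m) − ϱ*₁(m)|/m ≤ C·𝓛⁻⁸·τ₂(l₁)` (`b = Skeleton.bcoef`,
`κ̄₂ = Typed.Section17.kappa2bar`, `ϱ*₁ = Skeleton.varrhoStar · · 1`; in fact `≪ 𝓛⁻⁹³³τ₂(l₁)`).
[cite: Zhang2022LandauSiegel, §17 p.98 (u023); App. B (B.1) p.106] -/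
theorem swap17_bound (c' : ℝ) : ∃ C : ℝ, ForAllLarge fun D _ χ => AssumptionA D χ →
    ∀ l₁ : ℕ, 1 ≤ l₁ →
      ∑ m ∈ (Finset.Ico 1 ⌈bigP D⌉₊).filter (fun m => Nat.Coprime m (frakq D)),
        ‖bcoef D (l₁ * m)‖ *
          ‖χ (m : ZMod D) * Typed.Section17.kappa2bar c' D m - varrhoStar c' χ 1 m‖ / (m : ℝ) ≤
      C * (ell D ^ 8)⁻¹ * l₁.divisors.card := by
  obtain ⟨C₃₁, h31⟩ := Lemma31.lemma_3_1
  -- `|b(n)| ≤ C₀τ₂(n)` ((15.2)), with the constant made opaque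
  obtain ⟨C₀, hC00, hbC⟩ : ∃ C₀ : ℝ, 0 ≤ C₀ ∧ ∀ D : ℕ, 2 ≤ Real.log D → ∀ n : ℕ,
      ‖bcoef D n‖ ≤ C₀ * (n.divisors.card : ℝ) :=
    ⟨(1 + ‖iota2‖) * (‖iota3‖ + ‖iota4‖),
      mul_nonneg (add_nonneg zero_le_one (norm_nonneg _)) (add_nonneg (norm_nonneg _) (norm_nonneg _)),
      fun D hD n => by rw [← MeanSquareMajorant.tau_two_apply]; exact norm_bcoef_le hD n⟩
  -- `Σ_{k<N} τ₂(k)²/k ≤ M·log⁴` ((14.3)), constant opaque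
  obtain ⟨M, hM0, hMK⟩ : ∃ M : ℝ, 0 < M ∧ ∀ N : ℕ, 3 ≤ N →
      ∑ k ∈ Finset.Ico 1 N, ((k.divisors.card : ℝ) ^ 2 / k) ≤ M * Real.log ((N - 1 : ℕ) : ℝ) ^ 4 := by
    refine ⟨MeanSquareMajorant.majorantConst 4 4, MeanSquareMajorant.majorantConst_pos 4 4,
      fun N hN => ?_⟩
    have hIco : Finset.Ico 1 N = Finset.Icc 1 (N - 1) := by
      ext k; simp only [Finset.mem_Ico, Finset.mem_Icc]; omega
    rw [hIco]
    refine le_trans (le_of_eq (Finset.sum_congr rfl fun k _ => ?_))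
      (MeanSquareMajorant.sum_tau_sq_div_le 2 (X := N - 1) (by omega))
    rw [MeanSquareMajorant.tau_two_apply]
  refine ⟨C₀ * M * (|C₃₁| + M), ⌈Real.exp 3⌉₊, fun D _ χ hD hq hprim hA l₁ _ => ?_⟩
  -- parameters
  have hD3 : Real.exp 3 ≤ D := le_trans (Nat.le_ceil _) (by exact_mod_cast hD)
  have hD0 : (0 : ℝ) < D := lt_of_lt_of_le (Real.exp_pos 3) hD3
  have hlog : 3 ≤ Real.log D := (Real.le_log_iff_exp_le hD0).mpr hD3
  have hℓ3 : 3 ≤ ell D := by rw [ell]; exact hlog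
  have hℓ1 : 1 ≤ ell D := by linarith
  have hℓ0 : 0 < ell D := by linarith
  have hD2 : 2 ≤ D := by
    by_contra hlt
    have := Real.log_nonpos hD0.le (by exact_mod_cast (show D ≤ 1 by omega) : (D : ℝ) ≤ 1)
    linarith
  set N : ℕ := ⌈bigP D⌉₊ with hN
  set R : Finset ℕ := (Finset.Ico 1 N).filter (fun m => Nat.Coprime m (frakq D)) with hR
  have hP : 0 < bigP D := Real.exp_pos _
  have hP3 : (3 : ℝ) ≤ bigP D := by
    have h27 : (27 : ℝ) ≤ ell D ^ 9 := by nlinarith [pow_le_pow_left₀ (by norm_num : (0:ℝ) ≤ 3) hℓ3 9]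
    have := Real.add_one_le_exp (ell D ^ 9); rw [bigP]; linarith
  have hRsub : R ⊆ Finset.Ico 1 N := Finset.filter_subset _ _
  have hRdiv : ∀ n ∈ R, ∀ d : ℕ, d ∣ n → d ∈ R := by
    intro n hn d hd
    rw [hR, Finset.mem_filter, Finset.mem_Ico] at hn ⊢
    have hn0 : n ≠ 0 := by omega
    exact ⟨⟨Nat.pos_of_ne_zero (ne_zero_of_dvd_ne_zero hn0 hd),
      lt_of_le_of_lt (Nat.le_of_dvd (by omega) hd) hn.1.2⟩, hn.2.coprime_dvd_left hd⟩
  -- the weight `ν = |1 ∗ χ|`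
  set ν : ℕ → ℝ := fun h => ‖divisorSumChar χ h‖ with hν
  have hν0 : ∀ h, 0 ≤ ν h := fun h => norm_nonneg _
  have hτ : (0 : ℝ) ≤ l₁.divisors.card := Nat.cast_nonneg _
  -- Step 1: pointwise bounds, termwise
  have hterm : ∀ m ∈ R,
      ‖bcoef D (l₁ * m)‖ * ‖χ (m : ZMod D) * Typed.Section17.kappa2bar c' D m - varrhoStar c' χ 1 m‖ /
          (m : ℝ) ≤
        C₀ * l₁.divisors.card *
          ((m.divisors.card : ℝ) * (∑ h ∈ m.divisors.erase 1, ν h * ((m / h).divisors.card : ℝ)) / m) := by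
    intro m hm
    have hm1 := hRsub hm
    rw [Finset.mem_Ico] at hm1
    have hm0 : m ≠ 0 := by omega
    have hmpos : (0 : ℝ) < m := by exact_mod_cast hm1.1
    have hb : ‖bcoef D (l₁ * m)‖ ≤ C₀ * (l₁.divisors.card * m.divisors.card : ℝ) := by
      refine (hbC D (by linarith) (l₁ * m)).trans ?_
      refine mul_le_mul_of_nonneg_left ?_ hC00
      exact_mod_cast card_divisors_mul_le'' l₁ m
    have hΔ := norm_chi_mul_kappa2bar_sub_varrhoStar_le χ c' hm0
    rw [sum_divisors_sum_erase_eq hm0] at hΔ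
    rw [div_le_iff₀ hmpos]
    have hQ0 : 0 ≤ ∑ h ∈ m.divisors.erase 1, ν h * ((m / h).divisors.card : ℝ) :=
      Finset.sum_nonneg fun h _ => mul_nonneg (hν0 h) (Nat.cast_nonneg _)
    have hc0 : 0 ≤ C₀ * (l₁.divisors.card * m.divisors.card : ℝ) :=
      mul_nonneg hC00 (mul_nonneg hτ (Nat.cast_nonneg _))
    calc ‖bcoef D (l₁ * m)‖ * ‖χ (m : ZMod D) * Typed.Section17.kappa2bar c' D m - varrhoStar c' χ 1 m‖
        ≤ (C₀ * (l₁.divisors.card * m.divisors.card : ℝ)) *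
            ∑ h ∈ m.divisors.erase 1, ν h * ((m / h).divisors.card : ℝ) :=
          mul_le_mul hb hΔ (norm_nonneg _) hc0
      _ = C₀ * l₁.divisors.card *
          ((m.divisors.card : ℝ) * (∑ h ∈ m.divisors.erase 1, ν h * ((m / h).divisors.card : ℝ)) / m) * m := by
          field_simp
  -- Step 2: sum and rearrange
  set K : ℝ := ∑ k ∈ Finset.Ico 1 N, ((k.divisors.card : ℝ) ^ 2 / k) with hK
  set T₁ : ℝ := ∑ h ∈ R.erase 1, ν h * (h.divisors.card : ℝ) / h with hT₁
  have hK0 : 0 ≤ K := Finset.sum_nonneg fun k _ => by positivity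
  have hT10 : 0 ≤ T₁ := Finset.sum_nonneg fun h _ => by
    have := hν0 h; positivity
  have hS : ∑ m ∈ R, ‖bcoef D (l₁ * m)‖ *
        ‖χ (m : ZMod D) * Typed.Section17.kappa2bar c' D m - varrhoStar c' χ 1 m‖ / (m : ℝ) ≤
      C₀ * l₁.divisors.card * (T₁ * K) := by
    calc ∑ m ∈ R, ‖bcoef D (l₁ * m)‖ *
          ‖χ (m : ZMod D) * Typed.Section17.kappa2bar c' D m - varrhoStar c' χ 1 m‖ / (m : ℝ)
        ≤ ∑ m ∈ R, C₀ * l₁.divisors.card *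
            ((m.divisors.card : ℝ) * (∑ h ∈ m.divisors.erase 1, ν h * ((m / h).divisors.card : ℝ)) / m) :=
          Finset.sum_le_sum hterm
      _ = C₀ * l₁.divisors.card * ∑ m ∈ R,
            ((m.divisors.card : ℝ) * (∑ h ∈ m.divisors.erase 1, ν h * ((m / h).divisors.card : ℝ)) / m) := by
          rw [Finset.mul_sum]
      _ ≤ C₀ * l₁.divisors.card * (T₁ * K) :=
          mul_le_mul_of_nonneg_left (sum_tau_majorant_le hRsub hRdiv ν hν0) (mul_nonneg hC00 hτ)
  refine hS.trans ?_
  have hN3 : 3 ≤ N := by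
    have : (3 : ℝ) ≤ N := le_trans hP3 (Nat.le_ceil (bigP D))
    exact_mod_cast this
  have hlogN : Real.log ((N - 1 : ℕ) : ℝ) ≤ ell D ^ 9 := by
    have h1 : ((N - 1 : ℕ) : ℝ) < bigP D := by
      have := Nat.ceil_lt_add_one hP.le
      push_cast [Nat.cast_sub (by omega : 1 ≤ N)]
      rw [hN]; linarith
    have h0 : (0 : ℝ) < ((N - 1 : ℕ) : ℝ) := by exact_mod_cast (show 0 < N - 1 by omega)
    calc Real.log ((N - 1 : ℕ) : ℝ) ≤ Real.log (bigP D) := Real.log_le_log h0 h1.le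
      _ = ell D ^ 9 := by rw [bigP, Real.log_exp]
  have hlogN0 : 0 ≤ Real.log ((N - 1 : ℕ) : ℝ) := Real.log_natCast_nonneg _
  have hKb : K ≤ M * ell D ^ 36 := by
    refine (hMK N hN3).trans ?_
    calc M * Real.log ((N - 1 : ℕ) : ℝ) ^ 4 ≤ M * (ell D ^ 9) ^ 4 :=
          mul_le_mul_of_nonneg_left (pow_le_pow_left₀ hlogN0 hlogN 4) hM0.le
      _ = M * ell D ^ 36 := by ring
  -- `A₁ = Σ_{h∈R,h>1} ν²/h ≤ |C₃₁|/𝓛²⁰¹¹` (Lemma 3.1) and `A₂ = Σ τ²/h ≤ K`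
  have hA1 : ∑ h ∈ R.erase 1, ν h ^ 2 / h ≤ |C₃₁| / ell D ^ 2011 := by
    have hNexp : (N : ℝ) ≤ Real.exp (2 * Real.log D ^ 9) := by
      have : (N : ℝ) < bigP D + 1 := Nat.ceil_lt_add_one hP.le
      have h2 : Real.exp (2 * Real.log D ^ 9) = bigP D ^ 2 := by
        rw [bigP, ell, ← Real.exp_nat_mul]; norm_num
      rw [h2]; nlinarith
    have key := h31 D χ hprim hq.sq_eq_one hlog hA.le N hNexp
    have key' : ∑ n ∈ Finset.Ioc (D ^ 4) N, ‖divisorSumChar χ n‖ ^ 2 / n ≤ |C₃₁| / ell D ^ 2011 := by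
      rw [ell]; exact key.trans (div_le_div_of_nonneg_right (le_abs_self _) (by positivity))
    refine le_trans ?_ key'
    refine Finset.sum_le_sum_of_subset_of_nonneg ?_ fun h _ _ => by positivity
    intro h hh
    have hhR := Finset.mem_of_mem_erase hh
    have hh1 : h ≠ 1 := Finset.ne_of_mem_erase hh
    have hhI := hRsub hhR
    rw [Finset.mem_Ico] at hhI
    rw [Finset.mem_Ioc]
    exact ⟨pow_four_lt_of_coprime_frakq hD2 hh1 (by omega) (Finset.mem_filter.mp hhR).2, by omega⟩
  have hA2 : ∑ h ∈ R.erase 1, (h.divisors.card : ℝ) ^ 2 / h ≤ K :=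
    Finset.sum_le_sum_of_subset_of_nonneg ((Finset.erase_subset _ _).trans hRsub)
      fun h _ _ => by positivity
  -- Cauchy–Schwarz in the form `2fg ≤ λf² + g²/λ`, `λ = 𝓛¹⁰⁰⁵`
  have hlam0 : 0 < ell D ^ 1005 := pow_pos hℓ0 _
  have hT1 : T₁ ≤ (ell D ^ 1005 * ∑ h ∈ R.erase 1, ν h ^ 2 / h +
      (ell D ^ 1005)⁻¹ * ∑ h ∈ R.erase 1, (h.divisors.card : ℝ) ^ 2 / h) / 2 := by
    rw [hT₁, Finset.mul_sum, Finset.mul_sum, ← Finset.sum_add_distrib, Finset.sum_div]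
    refine Finset.sum_le_sum fun h hh => ?_
    have hh1 := hRsub (Finset.mem_of_mem_erase hh)
    rw [Finset.mem_Ico] at hh1
    have hh0 : (0 : ℝ) < h := by exact_mod_cast hh1.1
    exact mul_div_le_weighted hh0 hlam0
  have h969a : ell D ^ 1005 / ell D ^ 2011 ≤ 1 / ell D ^ 969 := pow_div_pow_le_one_div hℓ1 (by norm_num)
  have h969b : ell D ^ 36 / ell D ^ 1005 ≤ 1 / ell D ^ 969 := pow_div_pow_le_one_div hℓ1 (by norm_num)
  have h8 : ell D ^ 36 / ell D ^ 969 ≤ 1 / ell D ^ 8 := pow_div_pow_le_one_div hℓ1 (by norm_num)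
  have hi969 : 0 ≤ 1 / ell D ^ 969 := by positivity
  have hT1' : T₁ ≤ (|C₃₁| + M) * (1 / ell D ^ 969) := by
    refine hT1.trans ?_
    have h1 : ell D ^ 1005 * ∑ h ∈ R.erase 1, ν h ^ 2 / h ≤ |C₃₁| * (1 / ell D ^ 969) := by
      calc ell D ^ 1005 * ∑ h ∈ R.erase 1, ν h ^ 2 / h ≤ ell D ^ 1005 * (|C₃₁| / ell D ^ 2011) :=
            mul_le_mul_of_nonneg_left hA1 hlam0.le
        _ = |C₃₁| * (ell D ^ 1005 / ell D ^ 2011) := by ring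
        _ ≤ |C₃₁| * (1 / ell D ^ 969) := mul_le_mul_of_nonneg_left h969a (abs_nonneg _)
    have h2 : (ell D ^ 1005)⁻¹ * ∑ h ∈ R.erase 1, (h.divisors.card : ℝ) ^ 2 / h ≤
        M * (1 / ell D ^ 969) := by
      calc (ell D ^ 1005)⁻¹ * ∑ h ∈ R.erase 1, (h.divisors.card : ℝ) ^ 2 / h
          ≤ (ell D ^ 1005)⁻¹ * (M * ell D ^ 36) :=
            mul_le_mul_of_nonneg_left (hA2.trans hKb) (inv_nonneg.mpr hlam0.le)
        _ = M * (ell D ^ 36 / ell D ^ 1005) := by ring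
        _ ≤ M * (1 / ell D ^ 969) := mul_le_mul_of_nonneg_left h969b hM0.le
    have h0 : 0 ≤ (|C₃₁| + M) * (1 / ell D ^ 969) := mul_nonneg (by positivity) hi969
    nlinarith
  calc C₀ * l₁.divisors.card * (T₁ * K)
      ≤ C₀ * l₁.divisors.card * (((|C₃₁| + M) * (1 / ell D ^ 969)) * (M * ell D ^ 36)) := by
        refine mul_le_mul_of_nonneg_left ?_ (mul_nonneg hC00 hτ)
        exact mul_le_mul hT1' hKb hK0 (mul_nonneg (by positivity) hi969)
    _ = C₀ * M * (|C₃₁| + M) * (ell D ^ 36 / ell D ^ 969) * l₁.divisors.card := by ring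
    _ ≤ C₀ * M * (|C₃₁| + M) * (1 / ell D ^ 8) * l₁.divisors.card := by
        refine mul_le_mul_of_nonneg_right ?_ hτ
        refine mul_le_mul_of_nonneg_left h8 ?_
        exact mul_nonneg (mul_nonneg hC00 hM0.le) (by positivity)
    _ = C₀ * M * (|C₃₁| + M) * (ell D ^ 8)⁻¹ * l₁.divisors.card := by rw [one_div]

end Literature.NumberTheory.LFunctions.Zhang2022.Skeleton
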